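import Summits.QuantumFields.BalabanUV.Beta.WardLocusQuarticTable

/-!
# `BalabanUV.Beta.WardLocusQuarticSite` — binder row D1 ∕ gan24 row (C), (L4) W-side of hW: THE PER-SITE FORM OF THE NEXT LEVEL's SECOND-ORDER TABLE LAW —
# the index-slot law of `T2RecAt (j+1)` AT ONE SITE `y₀` of the step lattice with the per-site generator `diagK (½ • legInd ρ′ y₀)`, and its
# λ-WEIGHTED form (generator `diagK (Σ_{y₀} λ y₀ • legInd ρ′ y₀)` — a gauge function of finite support), from the SAME single hypothesis as the
# block law `WardLocusQuarticTable.tableLaw_T2RecAt_succ` (row D1 OWNER an2, gen 46; W-an2-g46-4 l.52613 for gan24-formalise-leaf-06 g51's ASK A-leaf06-g51-2)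

NOT IN PRINT; OUR BOOKKEEPING.  HONEST FRAMING (cell charter, verbatim): «discharging `BetaPertH` makes Bałaban's UV stability UNCONDITIONAL — a real
constructive-QFT result; it is NOT the continuum limit and NOT the Clay problem.»  HONEST DEPENDENCY (verbatim): «continuum YM on T⁴ ⇐ BetaPertH ∧ nine spine
estimates (0/9 proved); BetaPertH ⇐ (D1) ∧ (D4) ∧ CAP+tail; G-an2-4 gates asym, D1 and NE2/3/4.»  [folklore] kernel algebra over tree objects BY NAME; the
level-`j` kernel law of the carrier `WrecAt j` (residual `𝒩`) and the PER-SITE border letter of the `vh₂S` sector (remainder `RBs`) are DISPLAYED HYPOTHESES;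
no statement of Bałaban's papers, no `[cite:]`, no `def`, no `def … : Prop`; instantiates NO binder of the β-function wall; nothing of (C) ∕ (C)sym ∕ (Q-L) ∕
hW discharged.  NOT D1, NOT `BetaPertH`, NOT continuum, NOT Clay.

WHY.  `WardLocusQuartic.divV_e4OfKW_eq` (leaf-10 g3) is ALREADY per-site: the `mm`-read kills all but the `inl` part of the block generator, which IS `legInd ρ′ y₀`
at the ONE site `y₀` (`WardLocusCubic.mmSym_blockGen_inl`); `blockLaw_e4OfKW` ∕ `tableLaw_e4OfKW_sector` ∕ `tableLaw_T2RecAt_succ` are its block sums because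
`KernelWardSymAssembly`'s `hS₂` socket is block-shaped.  gan24 row (C) at levels `j ≥ 1` (leaf-06 g51, memo `C-LEVELS-GE1.md` §9 ∕ (T4)) contracts the table law
against a SAWTOOTH gauge function `λ` (zero block mean) — a PER-SITE weight —, i.e. wants the generator `½Λ = diagK (½ • Σ_{y₀} λ y₀ • legInd ρ′ y₀)`, which no
block law gives.  This file types the per-site law in the literal `hS₂` currency (`comp S X − comp X S + remainder`) and its λ-weighted form, generic and at the wall.
WHAT.
* §1 `siteSectorLaw_add` (per-site twin of `WardLocusQuarticTable.sectorLaw_add`); `siteLaw_e4OfKW_sector` (per-site twin of `WardLocusQuartic.tableLaw_e4OfKW_sector`: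
  same hypotheses, same lock `cH′·a₂·ξ = a₁·ξ′`, conclusion at ONE site `y₀` with generator `diagK (ξ′ • legInd ρ′ y₀)` and remainder `−(cH′·a₂) • mmRead N (K∘𝒩 y₀∘K)`);
  `siteLaw_e4OfKW_sector_conj` (the same as `(a₁·ξ′) • conjV T′ (diagK (legInd ρ′ y₀)) − …`); `siteLaw_e4OfKW_sector_weighted` (finite λ-weighted sum over sites:
  generator `diagK (Σ_{y₀∈T} λ y₀ • legInd ρ′ y₀)`, remainder `−(cH′·a₂) • Σ λ y₀ • mmRead N (K∘𝒩 y₀∘K)` — `WardLocusS0N.conjV_diagK_sum ∕ _smul`); `weighted_of_siteLaw` (abstract: any per-site `hS₂`-shaped law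
  summed against a finitely supported weight).
* §2 THE WALL at level `j+1` (pin `(cE, cVH) = (Lc^{d+1}, −Lc^{d+1}·½·Lc^{d+1})`, generator scale `½`, lock `cH′·(cE₂·wV4 (j+1))·½ = (Lc^{d+1}·wE (j+1))·½` as in
  `tableLaw_T2RecAt_succ`): `siteLaw_e4OfKW_wall` (the `e4OfKW` sector of `T2RecAt (j+1)` against the E-sector of `SpureRecAt (j+1)`, from `WardLocusQuarticWall.divV_e4OfKW_wall`;
  ONLY hypothesis `hWd`); **`siteLaw_T2RecAt_succ`** — the `hS₂` law of `T2RecAt (j+1)` against `SpureRecAt (j+1)` AT ONE SITE, the border sector's per-site letter `hBordSite`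
  DISPLAYED (an1's lane: `BorderWardSiteLaw.siteWardB` ∕ `SymBorderWardSiteLaw.symSiteWardB` are its models), remainder `−(cH′·cE₂·wV4 (j+1)) • mmRead Lc (G_j∘𝒩 y₀∘G_j) + RBs y₀`;
  `siteLaw_T2RecAt_succ_weighted` — the λ-weighted form (generator `diagK (½ • Σ_{y₀∈T} λ y₀ • legInd ρ′ y₀)`).
Provenance: row D1 OWNER an2 (b2b-balaban-beta-an2) gen 46, 2026-08-23; over `WardLocusQuartic{,Wall,Table}` BY NAME; no existing file touched.
-/

noncomputable section

open Finset
open scoped BigOperators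
open Literature.MathematicalPhysics.QuantumFieldTheory
open Literature.MathematicalPhysics.QuantumFieldTheory.Balaban1983to89
open Literature.MathematicalPhysics.QuantumFieldTheory.Balaban1983to89.Beta
open ExpKernelCalculus (MKer Decays BiLoc VertexFamily VertexFamily₂ comp)
open KernelWard (divV divW)
open AffineAveraging (box toSite)
open OneStepResolventKernel (Fib LocStencil)
open OneStepKernelFamily (KInvStep colH vertexOfK)
open BalabanStepJetsSucc (mmRead wE wVH)
open SecondOrderResponse (vertexOfM dM K2OfK LocStencilFM)
open BalabanCompositeJets (LocStencil₂)
open BalabanStepW2 (K3OfK wV4 wB2)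
open AveragingHessianKernelsRooted (vhSAt)
open Summit.QuantumFields.BalabanUV.Beta.TameKernelCalculus
open Summit.QuantumFields.BalabanUV.Beta.ChartConjugation (conjV)
open Summit.QuantumFields.BalabanUV.Beta.ChartConjugationRelative (RelInv)
open Summit.QuantumFields.BalabanUV.Beta.BorderedHessian (diagK bhKStepAt stepScale)
open Summit.QuantumFields.BalabanUV.Beta.AveragingWardRootedStencils (legInd)
open Summit.QuantumFields.BalabanUV.Beta.AxialDressingRooted (coDressKBmAt axEc)
open Summit.QuantumFields.BalabanUV.Beta.SpineRooted (e4OfKW SpureRecAt SpureRecAt_succ M1At e3OfK T2RecAt T2RecAt_succ WrecAt)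
open Summit.QuantumFields.BalabanUV.Beta.WardLocusRecursive (SrecAt)
open Summit.QuantumFields.BalabanUV.Beta.SecondOrderContactForm (add_comp_diagK diagK_comp_add)
open Summit.QuantumFields.BalabanUV.Beta.KernelWardMColumn (divV_add)
open Summit.QuantumFields.BalabanUV.Beta.WardLocusCubic (conjV_smul_diagK)
open Summit.QuantumFields.BalabanUV.Beta.WardLocusS0N (conjV_diagK_smul conjV_diagK_sum)
open Summit.QuantumFields.BalabanUV.Beta.WardLocusQuartic (divV_e4OfKW_eq divV_smul)
open Summit.QuantumFields.BalabanUV.Beta.WardLocusQuarticWall (divV_e4OfKW_wall)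

namespace Summit.QuantumFields.BalabanUV.Beta.WardLocusQuarticSite

/-! ## §1 Generic per-site letters -/

section Generic

variable {d N : ℕ}

/-- [folklore] **PER-SITE TABLE LAWS ADD OVER SECTORS** (the per-site twin of `WardLocusQuarticTable.sectorLaw_add`): a law at the site `y₀` for each sector of `S₂`
against the matching sector of `S`, same `cH`, same generator symbol `g y₀` ⇒ the law for the sums, remainders added. -/
theorem siteSectorLaw_add {S₂A S₂B : Fin (d + 1) → (Fin (d + 1) → ℤ) → Fin (d + 1) → (Fin (d + 1) → ℤ) → MKer (d + 1) (Fib d)}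
    {SA SB : Fin (d + 1) → (Fin (d + 1) → ℤ) → MKer (d + 1) (Fib d)} {g : (Fin (d + 1) → ℤ) → (Fin (d + 1) → ℤ) → Fib d → ℝ}
    {RA RB : (Fin (d + 1) → ℤ) → Fin (d + 1) → (Fin (d + 1) → ℤ) → MKer (d + 1) (Fib d)} {cH : ℝ}
    (hA : ∀ (y₀ : Fin (d + 1) → ℤ) (κ' : Fin (d + 1)) (u' : Fin (d + 1) → ℤ),
      cH • divV (fun κ u => S₂A κ u κ' u') y₀ = comp (SA κ' u') (diagK (g y₀)) - comp (diagK (g y₀)) (SA κ' u') + RA y₀ κ' u')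
    (hB : ∀ (y₀ : Fin (d + 1) → ℤ) (κ' : Fin (d + 1)) (u' : Fin (d + 1) → ℤ),
      cH • divV (fun κ u => S₂B κ u κ' u') y₀ = comp (SB κ' u') (diagK (g y₀)) - comp (diagK (g y₀)) (SB κ' u') + RB y₀ κ' u')
    (y₀ : Fin (d + 1) → ℤ) (κ' : Fin (d + 1)) (u' : Fin (d + 1) → ℤ) :
    cH • divV (fun κ u => S₂A κ u κ' u' + S₂B κ u κ' u') y₀ =
      comp (SA κ' u' + SB κ' u') (diagK (g y₀)) - comp (diagK (g y₀)) (SA κ' u' + SB κ' u') + (RA y₀ κ' u' + RB y₀ κ' u') := by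
  rw [divV_add (fun κ u => S₂A κ u κ' u') (fun κ u => S₂B κ u κ' u') y₀, smul_add, hA, hB, add_comp_diagK, diagK_comp_add]
  abel

/-- [folklore] **THE PER-SITE (T2-S₂)-SHAPED LAW OF THE `e4OfKW` SECTOR AT THE NEXT LEVEL** (the per-site twin of `WardLocusQuartic.tableLaw_e4OfKW_sector`: the SAME
hypotheses — `RelInv K 𝕄 E`, the first-order law `hD` and the second-order kernel law `hWd` of the carrier `W` at the block generator, residual `𝒩` — and the SAME lock
`cH′·a₂·ξ = a₁·ξ′`): at ONE site `y₀` of the step lattice, with the PER-SITE generator `diagK (ξ′ • legInd ρ′ y₀)` (any root `ρ′`),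
`cH′ • divV (a₂ • e4OfKW …) y₀ = comp (a₁ • T′) (diagK (ξ′ • legInd ρ′ y₀)) − comp (diagK (ξ′ • legInd ρ′ y₀)) (a₁ • T′) + (−(cH′·a₂)) • mmRead N (K∘𝒩 y₀∘K)`,
`T′ := mmRead N (K2OfK K N S M ν y′)` (`WardLocusQuartic.divV_e4OfKW_eq` scaled). -/
theorem siteLaw_e4OfKW_sector {K 𝕄 E : MKer (d + 1) (Fib d)} (hK : Spr K) (h𝕄 : Spr 𝕄) (hE : Spr E) (hR : RelInv K 𝕄 E)
    {S M : Fin (d + 1) → (Fin (d + 1) → ℤ) → MKer (d + 1) (Fib d)} (hDl : ∀ μ y, Loc (dM K N S M μ y))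
    {W : Fin (d + 1) → (Fin (d + 1) → ℤ) → Fin (d + 1) → (Fin (d + 1) → ℤ) → MKer (d + 1) (Fib d)} (hWl : ∀ μ y ν y', Loc (W μ y ν y'))
    {r : Fin (d + 1) → ℕ} (hr : r ∈ box (d + 1) N) (ξ : ℝ)
    (hX : ∀ y : Fin (d + 1) → ℤ, Loc (diagK (ξ • ∑ v ∈ box (d + 1) N, legInd (toSite r) ((N : ℤ) • y + toSite v))))
    (hEX : ∀ y : Fin (d + 1) → ℤ, comp E (diagK (ξ • ∑ v ∈ box (d + 1) N, legInd (toSite r) ((N : ℤ) • y + toSite v))) =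
      comp (diagK (ξ • ∑ v ∈ box (d + 1) N, legInd (toSite r) ((N : ℤ) • y + toSite v))) E)
    (hD : ∀ y : Fin (d + 1) → ℤ, divV (dM K N S M) y = conjV 𝕄 (diagK (ξ • ∑ v ∈ box (d + 1) N, legInd (toSite r) ((N : ℤ) • y + toSite v))))
    {𝒩 : (Fin (d + 1) → ℤ) → Fin (d + 1) → (Fin (d + 1) → ℤ) → MKer (d + 1) (Fib d)} (h𝒩 : ∀ y ν y', Loc (𝒩 y ν y'))
    (hWd : ∀ (y : Fin (d + 1) → ℤ) (ν : Fin (d + 1)) (y' : Fin (d + 1) → ℤ), divW W y ν y' =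
      conjV (dM K N S M ν y') (diagK (ξ • ∑ v ∈ box (d + 1) N, legInd (toSite r) ((N : ℤ) • y + toSite v))) + 𝒩 y ν y')
    {cH' a₁ a₂ ξ' : ℝ} (hlock : cH' * a₂ * ξ = a₁ * ξ') (ρ' y₀ : Fin (d + 1) → ℤ) (ν : Fin (d + 1)) (y' : Fin (d + 1) → ℤ) :
    cH' • divV (fun μ y => a₂ • e4OfKW N K S M W μ y ν y') y₀ =
      comp (a₁ • mmRead N (K2OfK K N S M ν y')) (diagK (ξ' • legInd ρ' y₀))
        - comp (diagK (ξ' • legInd ρ' y₀)) (a₁ • mmRead N (K2OfK K N S M ν y'))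
        + -(cH' * a₂) • mmRead N (comp (comp K (𝒩 y₀ ν y')) K) := by
  have hc : comp (a₁ • mmRead N (K2OfK K N S M ν y')) (diagK (ξ' • legInd ρ' y₀))
      - comp (diagK (ξ' • legInd ρ' y₀)) (a₁ • mmRead N (K2OfK K N S M ν y')) =
      (a₁ * ξ') • conjV (mmRead N (K2OfK K N S M ν y')) (diagK (legInd ρ' y₀)) := by
    rw [← smul_smul, ← conjV_diagK_smul, ← conjV_smul_diagK]; rfl
  rw [divV_smul, divV_e4OfKW_eq hK h𝕄 hE hR hDl hWl hr ξ hX hEX hD h𝒩 hWd ρ' y₀ ν y', smul_sub, smul_sub, smul_smul, smul_smul, smul_smul, hlock, hc,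
    neg_smul, sub_eq_add_neg]

/-- [folklore] The same law in `conjV` currency: `cH′ • divV (a₂ • e4OfKW …) y₀ = (a₁·ξ′) • conjV T′ (diagK (legInd ρ′ y₀)) − (cH′·a₂) • mmRead N (K∘𝒩 y₀∘K)`. -/
theorem siteLaw_e4OfKW_sector_conj {K 𝕄 E : MKer (d + 1) (Fib d)} (hK : Spr K) (h𝕄 : Spr 𝕄) (hE : Spr E) (hR : RelInv K 𝕄 E)
    {S M : Fin (d + 1) → (Fin (d + 1) → ℤ) → MKer (d + 1) (Fib d)} (hDl : ∀ μ y, Loc (dM K N S M μ y))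
    {W : Fin (d + 1) → (Fin (d + 1) → ℤ) → Fin (d + 1) → (Fin (d + 1) → ℤ) → MKer (d + 1) (Fib d)} (hWl : ∀ μ y ν y', Loc (W μ y ν y'))
    {r : Fin (d + 1) → ℕ} (hr : r ∈ box (d + 1) N) (ξ : ℝ)
    (hX : ∀ y : Fin (d + 1) → ℤ, Loc (diagK (ξ • ∑ v ∈ box (d + 1) N, legInd (toSite r) ((N : ℤ) • y + toSite v))))
    (hEX : ∀ y : Fin (d + 1) → ℤ, comp E (diagK (ξ • ∑ v ∈ box (d + 1) N, legInd (toSite r) ((N : ℤ) • y + toSite v))) =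
      comp (diagK (ξ • ∑ v ∈ box (d + 1) N, legInd (toSite r) ((N : ℤ) • y + toSite v))) E)
    (hD : ∀ y : Fin (d + 1) → ℤ, divV (dM K N S M) y = conjV 𝕄 (diagK (ξ • ∑ v ∈ box (d + 1) N, legInd (toSite r) ((N : ℤ) • y + toSite v))))
    {𝒩 : (Fin (d + 1) → ℤ) → Fin (d + 1) → (Fin (d + 1) → ℤ) → MKer (d + 1) (Fib d)} (h𝒩 : ∀ y ν y', Loc (𝒩 y ν y'))
    (hWd : ∀ (y : Fin (d + 1) → ℤ) (ν : Fin (d + 1)) (y' : Fin (d + 1) → ℤ), divW W y ν y' =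
      conjV (dM K N S M ν y') (diagK (ξ • ∑ v ∈ box (d + 1) N, legInd (toSite r) ((N : ℤ) • y + toSite v))) + 𝒩 y ν y')
    {cH' a₁ a₂ ξ' : ℝ} (hlock : cH' * a₂ * ξ = a₁ * ξ') (ρ' y₀ : Fin (d + 1) → ℤ) (ν : Fin (d + 1)) (y' : Fin (d + 1) → ℤ) :
    cH' • divV (fun μ y => a₂ • e4OfKW N K S M W μ y ν y') y₀ =
      (a₁ * ξ') • conjV (mmRead N (K2OfK K N S M ν y')) (diagK (legInd ρ' y₀)) - (cH' * a₂) • mmRead N (comp (comp K (𝒩 y₀ ν y')) K) := by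
  rw [divV_smul, divV_e4OfKW_eq hK h𝕄 hE hR hDl hWl hr ξ hX hEX hD h𝒩 hWd ρ' y₀ ν y', smul_sub, smul_sub, smul_smul, smul_smul, smul_smul, hlock]

/-- [folklore] **THE λ-WEIGHTED PER-SITE LAW** (finite support `T`, weight `lam`): the generator becomes `diagK (Σ_{y₀∈T} lam y₀ • legInd ρ′ y₀)` — a gauge function of
finite support read through the legs — and the remainder the weighted sum of the per-site remainders (`WardLocusS0N.conjV_diagK_sum ∕ conjV_diagK_smul`). -/
theorem siteLaw_e4OfKW_sector_weighted {K 𝕄 E : MKer (d + 1) (Fib d)} (hK : Spr K) (h𝕄 : Spr 𝕄) (hE : Spr E) (hR : RelInv K 𝕄 E)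
    {S M : Fin (d + 1) → (Fin (d + 1) → ℤ) → MKer (d + 1) (Fib d)} (hDl : ∀ μ y, Loc (dM K N S M μ y))
    {W : Fin (d + 1) → (Fin (d + 1) → ℤ) → Fin (d + 1) → (Fin (d + 1) → ℤ) → MKer (d + 1) (Fib d)} (hWl : ∀ μ y ν y', Loc (W μ y ν y'))
    {r : Fin (d + 1) → ℕ} (hr : r ∈ box (d + 1) N) (ξ : ℝ)
    (hX : ∀ y : Fin (d + 1) → ℤ, Loc (diagK (ξ • ∑ v ∈ box (d + 1) N, legInd (toSite r) ((N : ℤ) • y + toSite v))))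
    (hEX : ∀ y : Fin (d + 1) → ℤ, comp E (diagK (ξ • ∑ v ∈ box (d + 1) N, legInd (toSite r) ((N : ℤ) • y + toSite v))) =
      comp (diagK (ξ • ∑ v ∈ box (d + 1) N, legInd (toSite r) ((N : ℤ) • y + toSite v))) E)
    (hD : ∀ y : Fin (d + 1) → ℤ, divV (dM K N S M) y = conjV 𝕄 (diagK (ξ • ∑ v ∈ box (d + 1) N, legInd (toSite r) ((N : ℤ) • y + toSite v))))
    {𝒩 : (Fin (d + 1) → ℤ) → Fin (d + 1) → (Fin (d + 1) → ℤ) → MKer (d + 1) (Fib d)} (h𝒩 : ∀ y ν y', Loc (𝒩 y ν y'))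
    (hWd : ∀ (y : Fin (d + 1) → ℤ) (ν : Fin (d + 1)) (y' : Fin (d + 1) → ℤ), divW W y ν y' =
      conjV (dM K N S M ν y') (diagK (ξ • ∑ v ∈ box (d + 1) N, legInd (toSite r) ((N : ℤ) • y + toSite v))) + 𝒩 y ν y')
    {cH' a₁ a₂ ξ' : ℝ} (hlock : cH' * a₂ * ξ = a₁ * ξ') (ρ' : Fin (d + 1) → ℤ) (T : Finset (Fin (d + 1) → ℤ)) (lam : (Fin (d + 1) → ℤ) → ℝ)
    (ν : Fin (d + 1)) (y' : Fin (d + 1) → ℤ) :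
    cH' • ∑ y₀ ∈ T, lam y₀ • divV (fun μ y => a₂ • e4OfKW N K S M W μ y ν y') y₀ =
      (a₁ * ξ') • conjV (mmRead N (K2OfK K N S M ν y')) (diagK (∑ y₀ ∈ T, lam y₀ • legInd ρ' y₀))
        - (cH' * a₂) • ∑ y₀ ∈ T, lam y₀ • mmRead N (comp (comp K (𝒩 y₀ ν y')) K) := by
  rw [Finset.smul_sum, conjV_diagK_sum, Finset.smul_sum, Finset.smul_sum, ← Finset.sum_sub_distrib]
  refine Finset.sum_congr rfl fun y₀ _ => ?_
  rw [smul_comm cH' (lam y₀), siteLaw_e4OfKW_sector_conj hK h𝕄 hE hR hDl hWl hr ξ hX hEX hD h𝒩 hWd hlock ρ' y₀ ν y', conjV_diagK_smul, smul_sub,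
    smul_comm (lam y₀) (a₁ * ξ'), smul_comm (lam y₀) (cH' * a₂)]

/-- [folklore] **WEIGHTING A PER-SITE LAW BY A FINITELY SUPPORTED GAUGE FUNCTION** (abstract letters): if at every site `cH • D y₀ = comp S (diagK (ξ • g y₀)) − comp (diagK (ξ • g y₀)) S + R y₀`,
then for every finite `T` and weight `lam`, `cH • Σ_{y₀∈T} lam y₀ • D y₀ = comp S (diagK (ξ • Σ lam y₀ • g y₀)) − comp (diagK (ξ • Σ lam y₀ • g y₀)) S + Σ lam y₀ • R y₀` — the
generator becomes the λ-weighted leg indicator (`WardLocusS0N.conjV_diagK_sum ∕ conjV_diagK_smul`). -/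
theorem weighted_of_siteLaw {D R : (Fin (d + 1) → ℤ) → MKer (d + 1) (Fib d)} {S : MKer (d + 1) (Fib d)}
    {g : (Fin (d + 1) → ℤ) → (Fin (d + 1) → ℤ) → Fib d → ℝ} {cH ξ : ℝ}
    (h : ∀ y₀ : Fin (d + 1) → ℤ, cH • D y₀ = comp S (diagK (ξ • g y₀)) - comp (diagK (ξ • g y₀)) S + R y₀)
    (T : Finset (Fin (d + 1) → ℤ)) (lam : (Fin (d + 1) → ℤ) → ℝ) :
    cH • ∑ y₀ ∈ T, lam y₀ • D y₀ =
      comp S (diagK (ξ • ∑ y₀ ∈ T, lam y₀ • g y₀)) - comp (diagK (ξ • ∑ y₀ ∈ T, lam y₀ • g y₀)) S + ∑ y₀ ∈ T, lam y₀ • R y₀ := by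
  have hx : ξ • ∑ y₀ ∈ T, lam y₀ • g y₀ = ∑ y₀ ∈ T, lam y₀ • (ξ • g y₀) := by
    rw [Finset.smul_sum]; exact Finset.sum_congr rfl fun _ _ => smul_comm _ _ _
  calc cH • ∑ y₀ ∈ T, lam y₀ • D y₀ = ∑ y₀ ∈ T, lam y₀ • (cH • D y₀) := by
        rw [Finset.smul_sum]; exact Finset.sum_congr rfl fun _ _ => smul_comm _ _ _
    _ = ∑ y₀ ∈ T, (conjV S (diagK (lam y₀ • (ξ • g y₀))) + lam y₀ • R y₀) := by
        refine Finset.sum_congr rfl fun y₀ _ => ?_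
        rw [h y₀, conjV_diagK_smul, smul_add]; rfl
    _ = conjV S (diagK (∑ y₀ ∈ T, lam y₀ • (ξ • g y₀))) + ∑ y₀ ∈ T, lam y₀ • R y₀ := by
        rw [Finset.sum_add_distrib, conjV_diagK_sum]
    _ = comp S (diagK (ξ • ∑ y₀ ∈ T, lam y₀ • g y₀)) - comp (diagK (ξ • ∑ y₀ ∈ T, lam y₀ • g y₀)) S + ∑ y₀ ∈ T, lam y₀ • R y₀ := by
        rw [hx]; rfl

end Generic

/-! ## §2 The wall at level `j+1`: the per-site `hS₂` law of `T2RecAt (j+1)` -/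

section Wall

variable {d Lc : ℕ} [NeZero Lc]

/-- [folklore] **THE PER-SITE LAW OF THE `e4OfKW` SECTOR OF `T2RecAt (j+1)` AT THE WALL** (pin `(cE, cVH) = (Lc^{d+1}, −Lc^{d+1}·½·Lc^{d+1})`, generator scale `½`, in-block
root `ρ = toSite r`; `WardLocusQuarticWall.divV_e4OfKW_wall` scaled by the sector weight `cE₂·wV4 (j+1)` and the Ward constant `cH′` under the lock
`cH′·(cE₂·wV4 (j+1))·½ = (Lc^{d+1}·wE (j+1))·½`; ONLY hypothesis the level-`j` kernel law `hWd` of `WrecAt j` with residual `𝒩`): at ONE site `y₀`, any root `ρ′`,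
`cH′ • divV ((cE₂·wV4 (j+1)) • e4OfKW …) y₀ = comp ((Lc^{d+1}·wE (j+1)) • e3OfK Lc G_j (SrecAt j) ν y′) (diagK (½ • legInd ρ′ y₀)) − comp (diagK (½ • legInd ρ′ y₀)) (…)
+ (−(cH′·(cE₂·wV4 (j+1)))) • mmRead Lc (G_j∘𝒩 y₀ ν y′∘G_j)`. -/
theorem siteLaw_e4OfKW_wall (hLc : 1 ≤ Lc) {r : Fin (d + 1) → ℕ} (hr : r ∈ box (d + 1) Lc) (cΛ cE₂ cB : ℝ)
    (T : Fin 4 → Fin 4 → Fin 4 → Fin 4 → ℝ)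
    {vh₂S : Fin (d + 1) → (Fin (d + 1) → ℤ) → Fin (d + 1) → (Fin (d + 1) → ℤ) → MKer (d + 1) (Fib d)}
    (hB : ∃ C δ : ℝ, 0 < δ ∧ LocStencil₂ vh₂S C δ)
    {mixFF : Fin (d + 1) → (Fin (d + 1) → ℤ) → Fin (d + 1) → (Fin (d + 1) → ℤ) → MKer (d + 1) (Fib d)}
    (hmix : ∃ C δ : ℝ, 0 < δ ∧ LocStencilFM Lc mixFF C δ) (j : ℕ)
    {𝒩 : (Fin (d + 1) → ℤ) → Fin (d + 1) → (Fin (d + 1) → ℤ) → MKer (d + 1) (Fib d)} (h𝒩 : ∀ y ν y', Loc (𝒩 y ν y'))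
    (hWd : ∀ (y : Fin (d + 1) → ℤ) (ν : Fin (d + 1)) (y' : Fin (d + 1) → ℤ),
      divW (WrecAt d Lc (toSite r) ((Lc : ℝ) ^ (d + 1)) (-((Lc : ℝ) ^ (d + 1) * (1 / 2) * (Lc : ℝ) ^ (d + 1))) cΛ cE₂ cB T vh₂S mixFF j) y ν y' =
        conjV (dM (coDressKBmAt (toSite r) Lc (KInvStep (d := d) Lc j)) Lc
            (SpureRecAt d Lc (toSite r) ((Lc : ℝ) ^ (d + 1)) (-((Lc : ℝ) ^ (d + 1) * (1 / 2) * (Lc : ℝ) ^ (d + 1))) cΛ j)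
            (M1At d Lc (toSite r) cΛ j) ν y')
          (diagK (((1 : ℝ) / 2) • ∑ v ∈ box (d + 1) Lc, legInd (toSite r) ((Lc : ℤ) • y + toSite v))) + 𝒩 y ν y')
    {cH' : ℝ} (hlock : cH' * (cE₂ * wV4 d Lc (j + 1)) * ((1 : ℝ) / 2) = ((Lc : ℝ) ^ (d + 1) * wE d Lc (j + 1)) * ((1 : ℝ) / 2))
    (ρ' y₀ : Fin (d + 1) → ℤ) (ν : Fin (d + 1)) (y' : Fin (d + 1) → ℤ) :
    cH' • divV (fun μ y => (cE₂ * wV4 d Lc (j + 1)) •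
        e4OfKW Lc (coDressKBmAt (toSite r) Lc (KInvStep (d := d) Lc j))
          (SpureRecAt d Lc (toSite r) ((Lc : ℝ) ^ (d + 1)) (-((Lc : ℝ) ^ (d + 1) * (1 / 2) * (Lc : ℝ) ^ (d + 1))) cΛ j) (M1At d Lc (toSite r) cΛ j)
          (WrecAt d Lc (toSite r) ((Lc : ℝ) ^ (d + 1)) (-((Lc : ℝ) ^ (d + 1) * (1 / 2) * (Lc : ℝ) ^ (d + 1))) cΛ cE₂ cB T vh₂S mixFF j) μ y ν y') y₀ =
      comp (((Lc : ℝ) ^ (d + 1) * wE d Lc (j + 1)) •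
            e3OfK Lc (coDressKBmAt (toSite r) Lc (KInvStep (d := d) Lc j)) (SrecAt d Lc (toSite r) ((Lc : ℝ) ^ (d + 1)) (-((Lc : ℝ) ^ (d + 1) * (1 / 2) * (Lc : ℝ) ^ (d + 1))) cΛ j) ν y')
          (diagK (((1 : ℝ) / 2) • legInd ρ' y₀))
        - comp (diagK (((1 : ℝ) / 2) • legInd ρ' y₀))
          (((Lc : ℝ) ^ (d + 1) * wE d Lc (j + 1)) •
            e3OfK Lc (coDressKBmAt (toSite r) Lc (KInvStep (d := d) Lc j)) (SrecAt d Lc (toSite r) ((Lc : ℝ) ^ (d + 1)) (-((Lc : ℝ) ^ (d + 1) * (1 / 2) * (Lc : ℝ) ^ (d + 1))) cΛ j) ν y')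
        + -(cH' * (cE₂ * wV4 d Lc (j + 1))) •
            mmRead Lc (comp (comp (coDressKBmAt (toSite r) Lc (KInvStep (d := d) Lc j)) (𝒩 y₀ ν y')) (coDressKBmAt (toSite r) Lc (KInvStep (d := d) Lc j))) := by
  have hc : comp (((Lc : ℝ) ^ (d + 1) * wE d Lc (j + 1)) •
            e3OfK Lc (coDressKBmAt (toSite r) Lc (KInvStep (d := d) Lc j)) (SrecAt d Lc (toSite r) ((Lc : ℝ) ^ (d + 1)) (-((Lc : ℝ) ^ (d + 1) * (1 / 2) * (Lc : ℝ) ^ (d + 1))) cΛ j) ν y')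
          (diagK (((1 : ℝ) / 2) • legInd ρ' y₀))
        - comp (diagK (((1 : ℝ) / 2) • legInd ρ' y₀))
          (((Lc : ℝ) ^ (d + 1) * wE d Lc (j + 1)) •
            e3OfK Lc (coDressKBmAt (toSite r) Lc (KInvStep (d := d) Lc j)) (SrecAt d Lc (toSite r) ((Lc : ℝ) ^ (d + 1)) (-((Lc : ℝ) ^ (d + 1) * (1 / 2) * (Lc : ℝ) ^ (d + 1))) cΛ j) ν y') =
      (((Lc : ℝ) ^ (d + 1) * wE d Lc (j + 1)) * ((1 : ℝ) / 2)) •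
        conjV (e3OfK Lc (coDressKBmAt (toSite r) Lc (KInvStep (d := d) Lc j)) (SrecAt d Lc (toSite r) ((Lc : ℝ) ^ (d + 1)) (-((Lc : ℝ) ^ (d + 1) * (1 / 2) * (Lc : ℝ) ^ (d + 1))) cΛ j) ν y')
          (diagK (legInd ρ' y₀)) := by
    conv_rhs => rw [mul_smul, ← conjV_diagK_smul, ← conjV_smul_diagK]
    rfl
  rw [divV_smul, divV_e4OfKW_wall hLc hr cΛ cE₂ cB T hB hmix j h𝒩 hWd ρ' y₀ ν y', smul_sub, smul_sub, smul_smul, smul_smul, smul_smul, hlock, hc, neg_smul,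
    sub_eq_add_neg]

/-- **[folklore] `siteLaw_T2RecAt_succ` — THE `hS₂` LAW OF THE NEXT LEVEL's FIELD TABLE `T2RecAt (j+1)` AT ONE SITE** (the per-site twin of
`WardLocusQuarticTable.tableLaw_T2RecAt_succ`).  HYPOTHESES (displayed): the level-`j` KERNEL law `hWd` of `WrecAt j` with localised residual `𝒩` (the induction hypothesis); the
PER-SITE border letter `hBordSite` of the sector `(cB·wB2 (j+1)) • vh₂S` against `(cVH·wVH (j+1)) • vhSAt ρ` at the site `y₀` with the generator `diagK (½ • legInd ρ′ y₀)` and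
remainder `RBs` (an1's lane — `BorderWardSiteLaw.siteWardB` ∕ `SymBorderWardSiteLaw.symSiteWardB` are its models); the units lock `cH′·(cE₂·wV4 (j+1))·½ = (Lc^{d+1}·wE (j+1))·½`
(`WardLocusQuarticTable.lock_succ_of_pin`: ⟺ `cE₂ = Lc^{2(d+1)}`).  CONCLUSION: `cH′ • divV (T2RecAt (j+1) · κ′ u′) y₀ = comp (SpureRecAt (j+1) κ′ u′) (diagK (½ • legInd ρ′ y₀))
− comp (diagK (½ • legInd ρ′ y₀)) (SpureRecAt (j+1) κ′ u′) + (−(cH′·(cE₂·wV4 (j+1))) • mmRead Lc (G_j∘𝒩 y₀ κ′ u′∘G_j) + RBs y₀ κ′ u′)`. -/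
theorem siteLaw_T2RecAt_succ (hLc : 1 ≤ Lc) {r : Fin (d + 1) → ℕ} (hr : r ∈ box (d + 1) Lc) (cΛ cE₂ cB : ℝ)
    (T : Fin 4 → Fin 4 → Fin 4 → Fin 4 → ℝ)
    {vh₂S : Fin (d + 1) → (Fin (d + 1) → ℤ) → Fin (d + 1) → (Fin (d + 1) → ℤ) → MKer (d + 1) (Fib d)}
    (hB : ∃ C δ : ℝ, 0 < δ ∧ LocStencil₂ vh₂S C δ)
    {mixFF : Fin (d + 1) → (Fin (d + 1) → ℤ) → Fin (d + 1) → (Fin (d + 1) → ℤ) → MKer (d + 1) (Fib d)}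
    (hmix : ∃ C δ : ℝ, 0 < δ ∧ LocStencilFM Lc mixFF C δ) (j : ℕ)
    {𝒩 : (Fin (d + 1) → ℤ) → Fin (d + 1) → (Fin (d + 1) → ℤ) → MKer (d + 1) (Fib d)} (h𝒩 : ∀ y ν y', Loc (𝒩 y ν y'))
    (hWd : ∀ (y : Fin (d + 1) → ℤ) (ν : Fin (d + 1)) (y' : Fin (d + 1) → ℤ),
      divW (WrecAt d Lc (toSite r) ((Lc : ℝ) ^ (d + 1)) (-((Lc : ℝ) ^ (d + 1) * (1 / 2) * (Lc : ℝ) ^ (d + 1))) cΛ cE₂ cB T vh₂S mixFF j) y ν y' =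
        conjV (dM (coDressKBmAt (toSite r) Lc (KInvStep (d := d) Lc j)) Lc
            (SpureRecAt d Lc (toSite r) ((Lc : ℝ) ^ (d + 1)) (-((Lc : ℝ) ^ (d + 1) * (1 / 2) * (Lc : ℝ) ^ (d + 1))) cΛ j)
            (M1At d Lc (toSite r) cΛ j) ν y')
          (diagK (((1 : ℝ) / 2) • ∑ v ∈ box (d + 1) Lc, legInd (toSite r) ((Lc : ℤ) • y + toSite v))) + 𝒩 y ν y')
    {cH' : ℝ} (hlock : cH' * (cE₂ * wV4 d Lc (j + 1)) * ((1 : ℝ) / 2) = ((Lc : ℝ) ^ (d + 1) * wE d Lc (j + 1)) * ((1 : ℝ) / 2))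
    (ρ' : Fin (d + 1) → ℤ)
    {RBs : (Fin (d + 1) → ℤ) → Fin (d + 1) → (Fin (d + 1) → ℤ) → MKer (d + 1) (Fib d)}
    (hBordSite : ∀ (y₀ : Fin (d + 1) → ℤ) (κ' : Fin (d + 1)) (u' : Fin (d + 1) → ℤ),
      cH' • divV (fun κ u => (cB * wB2 d Lc (j + 1)) • vh₂S κ u κ' u') y₀ =
        comp ((-((Lc : ℝ) ^ (d + 1) * (1 / 2) * (Lc : ℝ) ^ (d + 1)) * wVH d Lc (j + 1)) • vhSAt (toSite r) d Lc rfl κ' u')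
            (diagK (((1 : ℝ) / 2) • legInd ρ' y₀))
          - comp (diagK (((1 : ℝ) / 2) • legInd ρ' y₀))
            ((-((Lc : ℝ) ^ (d + 1) * (1 / 2) * (Lc : ℝ) ^ (d + 1)) * wVH d Lc (j + 1)) • vhSAt (toSite r) d Lc rfl κ' u')
          + RBs y₀ κ' u')
    (y₀ : Fin (d + 1) → ℤ) (κ' : Fin (d + 1)) (u' : Fin (d + 1) → ℤ) :
    cH' • divV (fun κ u =>
        T2RecAt d Lc (toSite r) ((Lc : ℝ) ^ (d + 1)) (-((Lc : ℝ) ^ (d + 1) * (1 / 2) * (Lc : ℝ) ^ (d + 1))) cΛ cE₂ cB T vh₂S mixFF (j + 1) κ u κ' u') y₀ =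
      comp (SpureRecAt d Lc (toSite r) ((Lc : ℝ) ^ (d + 1)) (-((Lc : ℝ) ^ (d + 1) * (1 / 2) * (Lc : ℝ) ^ (d + 1))) cΛ (j + 1) κ' u')
          (diagK (((1 : ℝ) / 2) • legInd ρ' y₀))
        - comp (diagK (((1 : ℝ) / 2) • legInd ρ' y₀))
          (SpureRecAt d Lc (toSite r) ((Lc : ℝ) ^ (d + 1)) (-((Lc : ℝ) ^ (d + 1) * (1 / 2) * (Lc : ℝ) ^ (d + 1))) cΛ (j + 1) κ' u')
        + (-(cH' * (cE₂ * wV4 d Lc (j + 1))) •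
              mmRead Lc (comp (comp (coDressKBmAt (toSite r) Lc (KInvStep (d := d) Lc j)) (𝒩 y₀ κ' u'))
                (coDressKBmAt (toSite r) Lc (KInvStep (d := d) Lc j)))
            + RBs y₀ κ' u') := by
  have hA := fun (y : Fin (d + 1) → ℤ) (κ : Fin (d + 1)) (u : Fin (d + 1) → ℤ) =>
    siteLaw_e4OfKW_wall hLc hr cΛ cE₂ cB T hB hmix j h𝒩 hWd hlock ρ' y κ u
  have h := siteSectorLaw_add hA hBordSite y₀ κ' u'
  simpa only [T2RecAt_succ, SpureRecAt_succ] using h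

/-- [folklore] **THE λ-WEIGHTED `hS₂` LAW OF `T2RecAt (j+1)`** (finite support `T`, weight `lam`; `siteLaw_T2RecAt_succ` summed by `weighted_of_siteLaw`): generator
`diagK (½ • Σ_{y₀∈T} lam y₀ • legInd ρ′ y₀)` — the gauge function read through the legs —, remainder `Σ lam y₀ • (−(cH′·cE₂·wV4 (j+1)) • mmRead Lc (G_j∘𝒩 y₀∘G_j) + RBs y₀)`. -/
theorem siteLaw_T2RecAt_succ_weighted (hLc : 1 ≤ Lc) {r : Fin (d + 1) → ℕ} (hr : r ∈ box (d + 1) Lc) (cΛ cE₂ cB : ℝ)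
    (T : Fin 4 → Fin 4 → Fin 4 → Fin 4 → ℝ)
    {vh₂S : Fin (d + 1) → (Fin (d + 1) → ℤ) → Fin (d + 1) → (Fin (d + 1) → ℤ) → MKer (d + 1) (Fib d)}
    (hB : ∃ C δ : ℝ, 0 < δ ∧ LocStencil₂ vh₂S C δ)
    {mixFF : Fin (d + 1) → (Fin (d + 1) → ℤ) → Fin (d + 1) → (Fin (d + 1) → ℤ) → MKer (d + 1) (Fib d)}
    (hmix : ∃ C δ : ℝ, 0 < δ ∧ LocStencilFM Lc mixFF C δ) (j : ℕ)
    {𝒩 : (Fin (d + 1) → ℤ) → Fin (d + 1) → (Fin (d + 1) → ℤ) → MKer (d + 1) (Fib d)} (h𝒩 : ∀ y ν y', Loc (𝒩 y ν y'))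
    (hWd : ∀ (y : Fin (d + 1) → ℤ) (ν : Fin (d + 1)) (y' : Fin (d + 1) → ℤ),
      divW (WrecAt d Lc (toSite r) ((Lc : ℝ) ^ (d + 1)) (-((Lc : ℝ) ^ (d + 1) * (1 / 2) * (Lc : ℝ) ^ (d + 1))) cΛ cE₂ cB T vh₂S mixFF j) y ν y' =
        conjV (dM (coDressKBmAt (toSite r) Lc (KInvStep (d := d) Lc j)) Lc
            (SpureRecAt d Lc (toSite r) ((Lc : ℝ) ^ (d + 1)) (-((Lc : ℝ) ^ (d + 1) * (1 / 2) * (Lc : ℝ) ^ (d + 1))) cΛ j)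
            (M1At d Lc (toSite r) cΛ j) ν y')
          (diagK (((1 : ℝ) / 2) • ∑ v ∈ box (d + 1) Lc, legInd (toSite r) ((Lc : ℤ) • y + toSite v))) + 𝒩 y ν y')
    {cH' : ℝ} (hlock : cH' * (cE₂ * wV4 d Lc (j + 1)) * ((1 : ℝ) / 2) = ((Lc : ℝ) ^ (d + 1) * wE d Lc (j + 1)) * ((1 : ℝ) / 2))
    (ρ' : Fin (d + 1) → ℤ)
    {RBs : (Fin (d + 1) → ℤ) → Fin (d + 1) → (Fin (d + 1) → ℤ) → MKer (d + 1) (Fib d)}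
    (hBordSite : ∀ (y₀ : Fin (d + 1) → ℤ) (κ' : Fin (d + 1)) (u' : Fin (d + 1) → ℤ),
      cH' • divV (fun κ u => (cB * wB2 d Lc (j + 1)) • vh₂S κ u κ' u') y₀ =
        comp ((-((Lc : ℝ) ^ (d + 1) * (1 / 2) * (Lc : ℝ) ^ (d + 1)) * wVH d Lc (j + 1)) • vhSAt (toSite r) d Lc rfl κ' u')
            (diagK (((1 : ℝ) / 2) • legInd ρ' y₀))
          - comp (diagK (((1 : ℝ) / 2) • legInd ρ' y₀))
            ((-((Lc : ℝ) ^ (d + 1) * (1 / 2) * (Lc : ℝ) ^ (d + 1)) * wVH d Lc (j + 1)) • vhSAt (toSite r) d Lc rfl κ' u')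
          + RBs y₀ κ' u')
    (Tset : Finset (Fin (d + 1) → ℤ)) (lam : (Fin (d + 1) → ℤ) → ℝ) (κ' : Fin (d + 1)) (u' : Fin (d + 1) → ℤ) :
    cH' • ∑ y₀ ∈ Tset, lam y₀ • divV (fun κ u =>
        T2RecAt d Lc (toSite r) ((Lc : ℝ) ^ (d + 1)) (-((Lc : ℝ) ^ (d + 1) * (1 / 2) * (Lc : ℝ) ^ (d + 1))) cΛ cE₂ cB T vh₂S mixFF (j + 1) κ u κ' u') y₀ =
      comp (SpureRecAt d Lc (toSite r) ((Lc : ℝ) ^ (d + 1)) (-((Lc : ℝ) ^ (d + 1) * (1 / 2) * (Lc : ℝ) ^ (d + 1))) cΛ (j + 1) κ' u')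
          (diagK (((1 : ℝ) / 2) • ∑ y₀ ∈ Tset, lam y₀ • legInd ρ' y₀))
        - comp (diagK (((1 : ℝ) / 2) • ∑ y₀ ∈ Tset, lam y₀ • legInd ρ' y₀))
          (SpureRecAt d Lc (toSite r) ((Lc : ℝ) ^ (d + 1)) (-((Lc : ℝ) ^ (d + 1) * (1 / 2) * (Lc : ℝ) ^ (d + 1))) cΛ (j + 1) κ' u')
        + ∑ y₀ ∈ Tset, lam y₀ •
            ((-(cH' * (cE₂ * wV4 d Lc (j + 1)))) •
                mmRead Lc (comp (comp (coDressKBmAt (toSite r) Lc (KInvStep (d := d) Lc j)) (𝒩 y₀ κ' u'))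
                  (coDressKBmAt (toSite r) Lc (KInvStep (d := d) Lc j)))
              + RBs y₀ κ' u') :=
  weighted_of_siteLaw (fun y₀ => siteLaw_T2RecAt_succ hLc hr cΛ cE₂ cB T hB hmix j h𝒩 hWd hlock ρ' hBordSite y₀ κ' u') Tset lam

end Wall

end Summit.QuantumFields.BalabanUV.Beta.WardLocusQuarticSite

end
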